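import Literature.Analysis.FluidPDE.AncientMildPairing
import Literature.Analysis.FluidPDE.BoundedAnnihilator
import Literature.Analysis.FluidPDE.KNSSAxisymmetricNoSwirl
import HarnessLib

/-!
# The non-constant slice times of a bounded ancient mild solution form an open set

Analysis/FluidPDE support file (all results proved; no definitions, no named facts), continuing
`AncientMildPairing` / `BoundedAnnihilator` / `AncientMildDrift` (Koch–Nadirashvili–Seregin–Šverák
2009, §1 p. 3: the parasitic spatially constant solutions `u(x, t) = b(t)` of bounded weak / mild
Navier–Stokes). In the tree's duality-form class `IsBoundedAncientMildSolution ν u` of bounded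
ancient mild solutions a slice `u t`, `t < 0`, is seen only through its pairings with smooth
compactly supported divergence-free fields, which annihilate the constants; the *honest* times are
those `t < 0` whose slice is **not** a.e. equal to a constant (at such a final time every nonlinear
time integrand of the duality identity is honestly integrable,
`IsBoundedAncientMildSolution.intervalIntegrable_nonlinear_of_not_ae_const`). This file records
that the honest times form a (relatively) open subset of `(-∞, 0)`, so that an honest time is
approximable from the right by honest **rational** times — the countability device used when a
measurable gauge is assembled from countably many honest final times (the gauge bridge from the
duality-form class to KNSS's bounded weak solutions, crux `TypeIliouvilleL`).

Main results (any finite-dimensional real inner product space `E`, `u` a bounded ancient mild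
solution with measurable slices):

* `IsBoundedAncientMildSolution.exists_integral_inner_ne_zero_of_not_ae_const` — a slice which is
  not a.e. constant is **witnessed** by a divergence-free test field `φ` with `∫⟪u τ, φ⟫ ≠ 0`
  (contrapositive of the `L^∞` annihilator lemma
  `IsWeaklyDivFree.exists_ae_eq_const_of_norm_le_of_forall_integral_inner_eq_zero`, KNSS 2009
  Lemma 3.1: a bounded field with `curl = 0`, `div = 0` weakly is constant);
* `IsBoundedAncientMildSolution.exists_Ioo_forall_not_ae_const` — **openness** (`0 < ν`): if
  `u τ` is not a.e. constant then neither is `u t` for `|t - τ| < ε`, for some `ε > 0` with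
  `τ + ε ≤ 0` (the witness pairing `t ↦ ∫⟪u t, φ⟫` is continuous on `(-∞, 0)`,
  `IsBoundedAncientMildSolution.continuousOn_integral_inner`, and non-zero at `τ`, while it
  vanishes at every a.e.-constant slice, `integral_inner_const_eq_zero_of_isDivFree`);
* `IsBoundedAncientMildSolution.exists_seq_rat_tendsto_not_ae_const` — hence there is a sequence
  of **rational** honest times `q k ∈ (τ, 0)` with `q k → τ`.

What is NOT here: nothing about the joint measurability of `u` or the gauge itself; only the
slice-wise, elementary topology of the honest-time set.

## References

* G. Koch, N. Nadirashvili, G. Seregin, V. Šverák, *Liouville theorems for the Navier–Stokes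
  equations and applications*, Acta Math. 203 (2009) 83–105 = arXiv:0709.3599, §1 p. 3 (the
  parasitic solutions `u(x, t) = b(t)`), Lemma 3.1 p. 7 (bounded `curl`-free `div`-free fields
  are constant). [KochNadirashviliSereginSverak2009]
* folklore (continuity and density of `ℚ` in `ℝ`).
-/

noncomputable section

open MeasureTheory Set Function Filter Topology TopologicalSpace InnerProductSpace
open scoped RealInnerProductSpace NNReal ENNReal ContDiff

namespace Literature.Analysis.FluidPDE

variable {E : Type*} [NormedAddCommGroup E] [InnerProductSpace ℝ E] [FiniteDimensional ℝ E]
  [MeasurableSpace E] [BorelSpace E] {ν : ℝ} {u : ℝ → E → E}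

/-- **A non-constant slice is witnessed by a divergence-free test field.** Let `u` be a bounded
ancient mild solution (duality form) with measurable slices and `τ < 0`. If the slice `u τ` is not
a.e. equal to a constant, then some smooth compactly supported divergence-free `φ` has
`∫ ⟪u τ, φ⟫ ≠ 0`: otherwise `u τ`, a bounded weakly divergence-free field annihilating all
solenoidal tests, would be a.e. constant by the `L^∞` annihilator lemma
(`IsWeaklyDivFree.exists_ae_eq_const_of_norm_le_of_forall_integral_inner_eq_zero`; KNSS 2009,
Lemma 3.1). [folklore] -/
theorem IsBoundedAncientMildSolution.exists_integral_inner_ne_zero_of_not_ae_const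
    (hu : IsBoundedAncientMildSolution ν u) (hmeas : ∀ t < 0, AEStronglyMeasurable (u t) volume)
    {τ : ℝ} (hτ : τ < 0) (hnc : ∀ c : E, ¬ (u τ =ᵐ[volume] fun _ => c)) :
    ∃ φ : E → E, FunctionSpaces.IsTestFunctionOn (⊤ : Opens E) φ ∧ VectorCalculus.IsDivFree φ ∧
      ∫ x, ⟪u τ x, φ x⟫ ≠ 0 := by
  by_contra h
  push Not at h
  obtain ⟨M, hM⟩ := hu.2
  obtain ⟨c, hc⟩ :=
    IsWeaklyDivFree.exists_ae_eq_const_of_norm_le_of_forall_integral_inner_eq_zero (hmeas τ hτ)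
      (hM τ hτ) (hu.1.1 τ hτ) h
  exact hnc c hc

/-- **The times with non-constant slice form a (relatively) open set: right-neighbourhoods.**
Let `u` be a bounded ancient mild solution (`0 < ν`, duality form) with measurable slices, and
let `τ < 0` be a time whose slice `u τ` is not a.e. constant. Then there is `ε > 0` with
`τ + ε ≤ 0` such that no slice `u t`, `t ∈ (τ - ε, τ + ε)`, is a.e. constant. Proof: pick a
divergence-free test field `φ` with `∫⟪u τ, φ⟫ ≠ 0`
(`exists_integral_inner_ne_zero_of_not_ae_const`); the pairing `t ↦ ∫⟪u t, φ⟫` is continuous on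
`(-∞, 0)` (`IsBoundedAncientMildSolution.continuousOn_integral_inner`), hence non-zero near `τ`,
whereas at an a.e.-constant slice it vanishes (constants pair to zero with compactly supported
divergence-free fields, `integral_inner_const_eq_zero_of_isDivFree`; KNSS 2009, §1 p. 3). [folklore] -/
theorem IsBoundedAncientMildSolution.exists_Ioo_forall_not_ae_const
    (hu : IsBoundedAncientMildSolution ν u) (hν : 0 < ν)
    (hmeas : ∀ t < 0, AEStronglyMeasurable (u t) volume)
    {τ : ℝ} (hτ : τ < 0) (hnc : ∀ c : E, ¬ (u τ =ᵐ[volume] fun _ => c)) :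
    ∃ ε : ℝ, 0 < ε ∧ τ + ε ≤ 0 ∧ ∀ t ∈ Ioo (τ - ε) (τ + ε), ∀ c : E, ¬ (u t =ᵐ[volume] fun _ => c) := by
  obtain ⟨φ, hφ, hdiv, hne⟩ := hu.exists_integral_inner_ne_zero_of_not_ae_const hmeas hτ hnc
  have hφ1 : ContDiff ℝ 1 φ := hφ.contDiff.of_le (by exact_mod_cast le_top)
  have hcont : ContinuousAt (fun t => ∫ x, ⟪u t x, φ x⟫) τ :=
    (hu.continuousOn_integral_inner hν hmeas hφ hdiv τ hτ).continuousAt (Iio_mem_nhds hτ)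
  obtain ⟨δ, hδ, hδne⟩ := Metric.eventually_nhds_iff.1 (hcont.eventually_ne hne)
  refine ⟨min δ (-τ), lt_min hδ (neg_pos.2 hτ), by linarith [min_le_right δ (-τ)],
    fun t ht c hc => ?_⟩
  have htδ : dist t τ < δ := by
    rw [Real.dist_eq, abs_sub_lt_iff]
    constructor <;> linarith [ht.1, ht.2, min_le_left δ (-τ)]
  refine hδne htδ ?_
  rw [integral_congr_ae (show (fun x => ⟪u t x, φ x⟫) =ᵐ[volume] fun x => ⟪c, φ x⟫ by
    filter_upwards [hc] with x hx; rw [hx])]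
  exact integral_inner_const_eq_zero_of_isDivFree c hφ1 hφ.hasCompactSupport hdiv

/-- **A non-constant slice time is the limit of a decreasing sequence of rational non-constant
slice times.** Under the hypotheses of `exists_Ioo_forall_not_ae_const` there is a sequence of
rationals `q k` with `τ < q k < 0`, `q k → τ`, none of whose slices `u (q k)` is a.e. constant
(density of `ℚ`: pick `q k ∈ (τ, τ + ε / (k + 1))` inside the neighbourhood of
`exists_Ioo_forall_not_ae_const` and squeeze). [folklore] -/
theorem IsBoundedAncientMildSolution.exists_seq_rat_tendsto_not_ae_const
    (hu : IsBoundedAncientMildSolution ν u) (hν : 0 < ν)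
    (hmeas : ∀ t < 0, AEStronglyMeasurable (u t) volume)
    {τ : ℝ} (hτ : τ < 0) (hnc : ∀ c : E, ¬ (u τ =ᵐ[volume] fun _ => c)) :
    ∃ q : ℕ → ℚ, (∀ k, τ < (q k : ℝ)) ∧ (∀ k, (q k : ℝ) < 0) ∧
      (∀ k, ∀ c : E, ¬ (u (q k) =ᵐ[volume] fun _ => c)) ∧
      Tendsto (fun k => ((q k : ℝ))) atTop (𝓝 τ) := by
  obtain ⟨ε, hε, hτε, hgood⟩ := hu.exists_Ioo_forall_not_ae_const hν hmeas hτ hnc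
  have hr : ∀ k : ℕ, ∃ r : ℚ, τ < r ∧ (r : ℝ) < τ + ε / ((k : ℝ) + 1) := fun k =>
    exists_rat_btwn (lt_add_of_pos_right τ (by positivity))
  choose q hτq hqε using hr
  have hqlt : ∀ k, (q k : ℝ) < τ + ε := fun k => by
    have h1 : ε / ((k : ℝ) + 1) ≤ ε :=
      div_le_self hε.le (by linarith [(Nat.cast_nonneg k : (0 : ℝ) ≤ k)])
    linarith [hqε k]
  refine ⟨q, hτq, fun k => (hqlt k).trans_le hτε,
    fun k => hgood _ ⟨by linarith [hτq k], hqlt k⟩, ?_⟩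
  have hup : Tendsto (fun k : ℕ => τ + ε / ((k : ℝ) + 1)) atTop (𝓝 τ) := by
    have h1 : Tendsto (fun k : ℕ => ε / ((k : ℝ) + 1)) atTop (𝓝 0) := by
      have h := tendsto_one_div_add_atTop_nhds_zero_nat.const_mul ε
      rw [mul_zero] at h
      exact h.congr fun k => by ring
    simpa using h1.const_add τ
  exact tendsto_of_tendsto_of_tendsto_of_le_of_le tendsto_const_nhds hup (fun k => (hτq k).le)
    fun k => (hqε k).le

end Literature.Analysis.FluidPDE
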